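import Summits.BirchSwinnertonDyer.Rank1Residual.Additive.LocIrrOddPrimes
import HarnessLib

/-!
# X3 ∩ O5 at `p ≥ 5` lies inside Kraus's exceptional triplets (granted Kraus 1997 Prop. 2 alone);
# the `¬ CANON` rows of O5 are X4 rows (cell `b2b-bsdres`, lane CLASS-CLOSURE, classes O5 / X3;
# harvest seat 2, GEN 48, E102, part 3/3)

HONEST FRAMING (cell `b2b-bsdres`, run/shared/lean/b2b/bsd-rank1-residual/, verbatim in every
file): the goal of the cell is to DELETE the COMBINATION-SHAPED residual classes of the
Birch–Swinnerton-Dyer formula for ALL analytic-rank `≤ 1` elliptic curves over `ℚ` — "full BSD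
formula for every rank `≤ 1` curve in class `C`" assembled STRICTLY from published theorems — so
that the rank-`≤ 1` remainder becomes exactly the CONSTRUCTION-SHAPED classes, which are TYPED
(missing-input `Prop`s), NOT attempted. This is not "finishing BSD". Lane CLASS-CLOSURE: research
routes; no claim beyond the stated classes; nothing is booked here; no mark of `RESIDUAL-MAP.md`
moves. THEOREMS ONLY (no definition, no named fact, no conjecture node; net named-fact debt `0`);
the one published input is the tree's registered fact A255
`Literature.NumberTheory.EllipticCurves.Kraus1997.propTwo_pTorsion_of_supersingular` (Kraus,
Dissertationes Math. 364 (1997) Prop. 2 with Lemmes 1–2; harvest-2 GEN 46, p307235), BY NAME.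

## What this file does

GEN 46/47 made the node T-O5-CS a theorem granted A255: on the census cell `(t′)` of O5 at `p ≥ 5`,
`LocIrr W p ↔ ¬ CanonicalSubgroupCriterion p W` (`locIrr_iff_not_canonicalSubgroupCriterion_of_subTprime`).
Part 1/3 of E102 (`Additive/LocIrrOddPrimes.lean`) added `irr_of_locIrr : LocIrr W p → Irr W p`.
Read contrapositively on class X3 (`Red ∧ Addv`: a rational `p`-isogeny at an additive `p`):

* `not_locIrr_of_classX3` — an X3 pair is never `LocIrr` (the rational line is `G_{ℚ_p}`-stable);
* **`canonicalSubgroupCriterion_of_classX3_of_subTprime`** — granted A255, every X3 pair on `(t′)`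
  at `p ≥ 5` satisfies the canonical-subgroup criterion: on the globally minimal model,
  `(v_p(Δ), v_p(c₄)) ∈ {(2,1), (10,4), (4,2), (8,3)}` or `(v_p(Δ), v_p(c₆)) ∈ {(3,2), (9,5)}` —
  equivalently (`isExceptionalTriplet_of_classX3_of_subTprime`) `(v_p(c₄), v_p(c₆), v_p(Δ))` is one of
  Kraus's six exceptional triplets (Lemme 2, p. 10). On X3 the class O5 IS `(t′)`
  (`classO5_iff_subTprime_of_classX3`), whence `canonicalSubgroupCriterion_of_classX3_of_classO5`.
  Census reading (EVIDENCE; rmap-2 S-b: X3 ∩ O5 = `1 063` pairs at `p ≥ 5`, all `(t′)`): a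
  kernel PREDICTION that every one of them is a `CANON` row in the engines' sense — the reducible
  side of E94/E96's CANON law, which the census validated two-engine on the X4 (`r = 0`) rows only
  (LOCRED5-2ENG v1, 10 860 rows).
* **`classX4_of_classO5_of_not_canonicalSubgroupCriterion`** — granted A255, at `p ≥ 5` an O5 pair
  OFF the criterion (`NOCANON`: either `(G) ∧ ss`, where the criterion never fires, or `(t′)` with a
  non-minimal free invariant) is an X4 pair: `LocIrr` by T-O5-CS resp. part 1/3, then `Irr`.
  So at `p ≥ 5` the O5 class splits as `CANON ⊇ X3 ∩ O5` and `NOCANON ⊆ X4 ∩ O5`, with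
  `LocIrr ↔ NOCANON` (`locIrr_iff_not_canonicalSubgroupCriterion_of_classO5`, GEN 47).

Nothing is booked; no label / mark / count moves (the census labels CANON / NOCANON are
census-lead's); O5 and X3 stay OPEN (these are hypothesis bits, not `p`-part statements).

References: A. Kraus, Dissertationes Math. 364 (1997), Prop. 2 (p. 10), Lemme 1 (p. 8), Lemme 2
(p. 10) [Kraus1997Dissertationes]; B. Mazur, Publ. Math. IHÉS 47 (1977), Ch. III §5 p. 157
[Mazur1977]; J.-P. Serre, Invent. Math. 15 (1972) §1.11 Prop. 12 [Serre1972]; cell: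
HOME/b2b-bsdres-harvest-2/gen44/E94–E96, gen46/E100, gen47/E101, gen48/E102.
-/

set_option autoImplicit false

noncomputable section

open scoped Classical

open WeierstrassCurve Literature.NumberTheory.EllipticCurves
  Literature.NumberTheory.EllipticCurves.Rank1Residual
  Literature.NumberTheory.EllipticCurves.Kraus1997

namespace Summit.BirchSwinnertonDyer.Rank1Residual.Additive

section X3

variable (W : WeierstrassCurve ℚ) [W.IsElliptic] [W.IsGloballyMinimal] (p : ℕ) [hp : Fact p.Prime]

omit [W.IsGloballyMinimal] in
/-- **An X3 pair is never `LocIrr`**: the kernel of the rational `p`-isogeny is a `Γ_ℚ`-stable, hence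
`G_{ℚ_p}`-stable, line (`not_locIrr_of_red`, part 1/3). [folklore] -/
theorem not_locIrr_of_classX3 (hX : ClassX3 W p) : ¬ LocIrr W p := not_locIrr_of_red W p hX.1

/-- **Granted Kraus 1997 Prop. 2 (A255), every X3 pair on `(t′)` at `p ≥ 5` satisfies the
canonical-subgroup criterion** — `(v_p(Δ), v_p(c₄)) ∈ {(2,1), (10,4), (4,2), (8,3)}` or
`(v_p(Δ), v_p(c₆)) ∈ {(3,2), (9,5)}` on the globally minimal model: otherwise T-O5-CS
(`locIrr_of_not_canonicalSubgroupCriterion_of_subTprime`, GEN 46) would make `E[p]|G_{ℚ_p}`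
irreducible, contradicting the rational `p`-line.
[cite: Kraus1997Dissertationes, Prop. 2 (p. 10), Lemme 1 (p. 8), Lemme 2 (p. 10)] -/
theorem canonicalSubgroupCriterion_of_classX3_of_subTprime (hK : propTwo_pTorsion_of_supersingular)
    (hp5 : 5 ≤ p) (hX : ClassX3 W p) (hT : SubTprime W p) : CanonicalSubgroupCriterion p W := by
  by_contra hc
  exact not_locIrr_of_classX3 W p hX
    (locIrr_of_not_canonicalSubgroupCriterion_of_subTprime W p hK hp5 hX.2 hT hc)

/-- The same in Kraus's own vocabulary: the minimal model's `(v_p(c₄), v_p(c₆), v_p(Δ))` is one of the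
six exceptional triplets of Lemme 2 (`canonicalSubgroupCriterion_iff_isExceptionalTriplet`, GEN 46).
[cite: Kraus1997Dissertationes, Lemme 2 (p. 10)] -/
theorem isExceptionalTriplet_of_classX3_of_subTprime (hK : propTwo_pTorsion_of_supersingular)
    (hp5 : 5 ≤ p) (hX : ClassX3 W p) (hT : SubTprime W p) : IsExceptionalTriplet p W :=
  (canonicalSubgroupCriterion_iff_isExceptionalTriplet W hp5).mp
    (canonicalSubgroupCriterion_of_classX3_of_subTprime W p hK hp5 hX hT)

/-- **X3 ∩ O5 at `p ≥ 5` is inside the criterion** (on X3, class O5 is exactly `(t′)`: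
`classO5_iff_subTprime_of_classX3`). Census reading: rmap-2 S-b lists `1 063` such pairs — all
predicted `CANON`. [cite: Kraus1997Dissertationes, Prop. 2 (p. 10)] -/
theorem canonicalSubgroupCriterion_of_classX3_of_classO5 (hK : propTwo_pTorsion_of_supersingular)
    (hp5 : 5 ≤ p) (hX : ClassX3 W p) (hO : ClassO5 W p) : CanonicalSubgroupCriterion p W :=
  canonicalSubgroupCriterion_of_classX3_of_subTprime W p hK hp5 hX
    ((classO5_iff_subTprime_of_classX3 W p (by omega) hX).mp hO)

/-- Contrapositive bookkeeping: at `p ≥ 5` an X3 ∩ O5 pair never has `v_p(Δ_min) = 6` (the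
criterion does not fire at `6`, `canonicalSubgroupCriterion_false_of_Δ_six`) — the I₀* rows of O5 are
X4 rows. [cite: Kraus1997Dissertationes, Lemme 2 (p. 10), case v(Δ) = 6] -/
theorem padicValRat_Δ_ne_six_of_classX3_of_classO5 (hK : propTwo_pTorsion_of_supersingular)
    (hp5 : 5 ≤ p) (hX : ClassX3 W p) (hO : ClassO5 W p) : padicValRat p W.Δ ≠ 6 := fun h6 ↦
  canonicalSubgroupCriterion_false_of_Δ_six h6
    (canonicalSubgroupCriterion_of_classX3_of_classO5 W p hK hp5 hX hO)

end X3

/-! ## The O5 dichotomy at `p ≥ 5` granted A255: `NOCANON` rows are X4 rows -/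

section O5

variable (W : WeierstrassCurve ℚ) [W.IsElliptic] [W.IsGloballyMinimal] (p : ℕ) [hp : Fact p.Prime]

/-- **Granted A255, an O5 pair at `p ≥ 5` OFF the canonical-subgroup criterion is an X4 pair**:
on `(G) ∧ ss` by part 1/3 (`classX4_of_subGss_of_ne_two`, no fact needed); on `(t′)` by T-O5-CS
(`locIrr_of_not_canonicalSubgroupCriterion_of_subTprime`) and `irr_of_locIrr`.
[cite: Kraus1997Dissertationes, Prop. 2 (p. 10)] [cite: Serre1972, §1.11 Prop. 12] -/
theorem classX4_of_classO5_of_not_canonicalSubgroupCriterion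
    (hK : propTwo_pTorsion_of_supersingular) (hp5 : 5 ≤ p) (hO : ClassO5 W p)
    (hc : ¬ CanonicalSubgroupCriterion p W) : ClassX4 W p := by
  obtain ⟨hp2, hadd, hG | hT⟩ := hO
  · exact classX4_of_subGss_of_ne_two W p hp2 hadd hG
  · exact classX4_of_addv_of_locIrr W p hp2 hadd
      (locIrr_of_not_canonicalSubgroupCriterion_of_subTprime W p hK hp5 hadd hT hc)

/-- **The O5 dichotomy at `p ≥ 5`, granted A255**: every O5 pair is a `CANON` row or an X4 pair
(and `LocIrr ↔ NOCANON`, `locIrr_iff_not_canonicalSubgroupCriterion_of_classO5`).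
[cite: Kraus1997Dissertationes, Prop. 2 (p. 10)] -/
theorem canonicalSubgroupCriterion_or_classX4_of_classO5 (hK : propTwo_pTorsion_of_supersingular)
    (hp5 : 5 ≤ p) (hO : ClassO5 W p) : CanonicalSubgroupCriterion p W ∨ ClassX4 W p := by
  by_cases hc : CanonicalSubgroupCriterion p W
  · exact Or.inl hc
  · exact Or.inr (classX4_of_classO5_of_not_canonicalSubgroupCriterion W p hK hp5 hO hc)

end O5

end Summit.BirchSwinnertonDyer.Rank1Residual.Additive

end
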